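import Literature.Computability.AlgebraicComplexity.QuantumFunctionalsKronecker
import HarnessLib

/-!
# Multiplicativity of the quantum functional: reduction to sub-multiplicativity (CVZ Cor. 3.31)

Topic: `Literature/Computability/AlgebraicComplexity`; decomposition file for the named fact
`ChristandlVranaZuiddam2023_kronecker` (`QuantumFunctionals.lean`; Christandl–Vrana–Zuiddam,
J. Amer. Math. Soc. 36 (2023), Cor. 3.31: `F^θ(s ⊗ t) = F^θ(s) F^θ(t)` for `θ ∈ P([3])`).

In the source, multiplicativity of `F^θ = F_θ` (Cor. 3.31) is the conjunction of two inequalities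
with proofs of very different depth:

* `F_θ(s ⊗ t) ≥ F_θ(s) F_θ(t)` — Thm. 3.19.3 = Lemma 3.23, elementary; PROVED in
  `QuantumFunctionalsKronecker.lean` as `ChristandlVranaZuiddam2023_kronecker_ge`.
* `F_θ(s ⊗ t) ≤ F_θ(s) F_θ(t)` — obtained as `F_θ ≤ F^θ` (Thm. 3.24: Keyl–Werner spectrum
  estimation, Thm. 3.27, and the gentle measurement lemma, Lemma 3.25), `F^θ(s ⊗ t) ≤ F^θ(s) F^θ(t)`
  for the *upper* quantum functional defined through the isotypic projectors of Schur–Weyl duality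
  (Def. 3.3, Lemma 3.13: semigroup property of Kronecker coefficients, Rem. 3.9, and the entropy
  inequality `g_{λμν} ≠ 0 ⇒ H(λ̄) ≤ H(μ̄) + H(ν̄)`, Lemma 3.10.1), and `F^θ = F_θ` on `P_s(B)`
  (Thm. 3.30, via the entanglement-polytope characterisation Thm. 3.29 of
  Brion / Walter–Doran–Gross–Christandl / Christandl–Doran–Kousidis–Walter). None of this
  representation theory is in Mathlib at present.

This file vendors the second inequality as the named fact `ChristandlVranaZuiddam2023_kronecker_le`
(statement exactly the `≤` half of Cor. 3.31 for `k = 3`, same format as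
`ChristandlVranaZuiddam2023_kronecker`) and proves the assembly
`ChristandlVranaZuiddam2023_kronecker_of_le : _kronecker_le → _kronecker` together with the converse
projection `ChristandlVranaZuiddam2023_kronecker.le`, so that discharging `_kronecker` is reduced to
discharging `_kronecker_le`.

## Source

M. Christandl, P. Vrana, J. Zuiddam, *Universal points in the asymptotic spectrum of tensors*,
J. Amer. Math. Soc. 36 (2023) 31–79 = arXiv:1709.07851v3: Lemma 3.13 (p. 14), Thm. 3.24 (p. 15),
Thm. 3.30 and Cor. 3.31 (p. 16).
-/

noncomputable section

open scoped BigOperators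

namespace Literature.Computability.AlgebraicComplexity

universe u

/-- **CVZ, sub-multiplicativity of the quantum functional** (the `≤` half of Cor. 3.31, `k = 3`):
`F^θ(s ⊗ t) ≤ F^θ(s) F^θ(t)` for every `θ ∈ P([3])` and all complex 3-tensors `s`, `t`, where
`F^θ = quantumFunctional θ` (Def. 3.16, the functional `F_θ` of the source) and
`s ⊗ t = kroneckerTensor s t`. In the source this is `F_θ ≤ F^θ` (Thm. 3.24) combined with the
sub-multiplicativity of the upper quantum functional `F^θ` (Lemma 3.13 = Thm. 3.5.3) and
`F^θ = F_θ` for `θ ∈ P_s(B) ⊇ P([3])` (Thm. 3.30).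
[cite: ChristandlVranaZuiddam2023, Cor. 3.31 (with Lemma 3.13, Thm. 3.24, Thm. 3.30)] -/
def ChristandlVranaZuiddam2023_kronecker_le : Prop :=
  ∀ (θ : Fin 3 → ℝ), θ ∈ stdSimplex ℝ (Fin 3) →
    ∀ {ι κ μ ι' κ' μ' : Type u} [Fintype ι] [Fintype κ] [Fintype μ] [Fintype ι'] [Fintype κ']
      [Fintype μ'] [DecidableEq ι] [DecidableEq κ] [DecidableEq μ] [DecidableEq ι'] [DecidableEq κ']
      [DecidableEq μ'] (s : ι → κ → μ → ℂ) (t : ι' → κ' → μ' → ℂ),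
    quantumFunctional θ (kroneckerTensor s t) ≤ quantumFunctional θ s * quantumFunctional θ t

/-- **Assembly of CVZ Cor. 3.31 (multiplicativity) from its two halves**: the proved
super-multiplicativity `ChristandlVranaZuiddam2023_kronecker_ge` (Thm. 3.19.3) and the named fact
`ChristandlVranaZuiddam2023_kronecker_le` give `F^θ(s ⊗ t) = F^θ(s) F^θ(t)`.
[cite: ChristandlVranaZuiddam2023, Cor. 3.31] -/
theorem ChristandlVranaZuiddam2023_kronecker_of_le (h : ChristandlVranaZuiddam2023_kronecker_le.{u}) :
    ChristandlVranaZuiddam2023_kronecker.{u} :=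
  fun θ hθ _ _ _ _ _ _ _ _ _ _ _ _ _ _ _ _ _ _ s t =>
    le_antisymm (h θ hθ s t) (ChristandlVranaZuiddam2023_kronecker_ge θ hθ s t)

/-- Conversely, multiplicativity (Cor. 3.31) contains the sub-multiplicativity half.
[cite: ChristandlVranaZuiddam2023, Cor. 3.31] -/
theorem ChristandlVranaZuiddam2023_kronecker.le (h : ChristandlVranaZuiddam2023_kronecker.{u}) :
    ChristandlVranaZuiddam2023_kronecker_le.{u} :=
  fun θ hθ _ _ _ _ _ _ _ _ _ _ _ _ _ _ _ _ _ _ s t => (h θ hθ s t).le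

/-- The two halves are equivalent to the whole: `_kronecker ↔ _kronecker_le`, given the proved
`≥` half. [cite: ChristandlVranaZuiddam2023, Cor. 3.31] -/
theorem ChristandlVranaZuiddam2023_kronecker_iff_le :
    ChristandlVranaZuiddam2023_kronecker.{u} ↔ ChristandlVranaZuiddam2023_kronecker_le.{u} :=
  ⟨ChristandlVranaZuiddam2023_kronecker.le, ChristandlVranaZuiddam2023_kronecker_of_le⟩

end Literature.Computability.AlgebraicComplexity

end
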